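import Summits.QuantumFields.BalabanUV.Beta.D1BFx.KTransferTorus
import Summits.QuantumFields.BalabanUV.Beta.D1BFx.TorusCoframeJets

/-!
# `BalabanUV.Beta.D1BFx.KGhostTerm` — road «BF-x» for binder row D1, slot (K), `K-ASSEMBLY-SPEC-v2.md` §4 brick **TB5-2c-A: THE GHOST (Φ-) TERM OF
# ROUTE T UNDER (R2) IS A COMB-FREE SCALAR ONE-LOOP FUNCTIONAL** (owner NOTE ρ-g6-13b, ruling ρ-g7-1).  On every coarse torus, at the canonical comb basis
# `N̂ = TorusGaugeBasisMatrix.Nhat` and at «TB4-W» PART 2's co-frame ∕ inverse jets (`TorusCoframeJets.Tjet•`, `Ajet•`, d1-formalise-leaf-03-g9 p243088),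
# the SECOND summand of TB5-1 `KTransferTorus.hessT_transfer_road_Nhat` — the FP-Gram functional `hessT ((Ŵ₀ᵀB₀Ŵ₀)⁻¹; Ŵ₀ᵀB•Ŵ₀)` — EQUALS
#   `2·hessT (Ĉ; M̂ₛD̂, M̂ₜD̂, M̂ₛₜD̂) − hessT (Ĉ; (L̂²)ₛ, (L̂²)ₜ, (L̂²)ₛₜ)`,   `Ĉ := N̂·(N̂ᵀL̂L̂N̂)⁻¹·N̂ᵀ` (site × site),
# i.e. a difference of two SCALAR one-loop functionals over ONE fixed leg `Ĉ` (leaf-03-g9's PART 3a `Chat`, `= (m+1)⁴•Ĝ′(1 − P̂)Ĝ′`) and LOCAL site jets —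
# the «X-word» `M̂•·D̂` (`M̂(U) = L̂_U D̂_U*`, NOTE ρ-g6-13b (ii)) and the bi-Laplacian word `(L̂²)•` (the `A`-term, `TorusCoframeJets.hessT_Ajet_road`) — with
# the comb index `ρ` ELIMINATED (trace cyclicity).  §4 re-states TB5-1 with this ghost term: the per-torus identity of route T in which EVERY functional is
# «one fixed periodic leg × local jets» — the shape of the `p → ∞` sockets (`SortedTraces`, `TorusTraceTadpole`; TB5-2c-B after PART 3a∕3b)

HONEST FRAMING (cell contract, verbatim): «discharging `BetaPertH` makes Bałaban's UV stability UNCONDITIONAL — a real constructive-QFT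
result; it is NOT the continuum limit and NOT the Clay problem.»  HONEST DEPENDENCY (verbatim): «continuum YM on T⁴ ⇐ BetaPertH ∧ nine
spine estimates (0/9 proved); BetaPertH ⇐ (D1) ∧ (D4) ∧ CAP+tail; G-an2-4 gates asym, D1 and NE2/3/4.»  THIS MODULE DISCHARGES NOTHING of
D1 / BetaPertH: [folklore] finite matrix algebra (trace cyclicity, re-indexing over the `Equiv` `e₁`) + compositions BY NAME of gan24-leaf-03-g44's
`GramWeightJetsMixed.hessT_gram_split_jets`, leaf-03-g9's `TorusCoframeJets` (`Tjet₀_eq_coframe`, `hessT_Ajet_road`), gan24-leaf-06-g31's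
`TorusHodgeWeight.Dhat_transpose_mul_Dhat`, ne9-leaf-09-g38's `TorusGaugeBasisKernel` and this lineage's `KTransferTorus`.  No `def`, no `def … : Prop`,
nothing cited, 0 sorry.  DISPLAYED (what (K) still owes per torus): the table jets with their kinematic Ward letters (TB4 (T1)∕(T2-kin)), `Spr (Ga (m+1) a)`
(printed [B5, Prop. 1.2] ∧ [(1.126)–(1.127)], `GluonLegTails.spr_Ga_of_prop12`).  The (R2) bookkeeping (B-independent gauge basis) is ruling ρ-g6-12; whether
its ghost term matches the END's tower∕coarse-Gram rows modulo the unit class is the X₄ read-out (OWNER FINDING F-g7-1), NOT settled here.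
NOT summit progress; NOT BetaPertH, NOT continuum, NOT Clay.

ABSOLUTE RULE (cell, verbatim): «No internally-minted statement may enter as a cited fact. Every hypothesis is either kernel-proved in this
package or a verbatim quotation of a PUBLISHED theorem with page reference. The manuscript(s) under audit are NOT citable for their own
disputed steps — they are the thing under adjudication; programme-internal (2001/route/tribunal) claims are never citable.»

CONTENT (all [folklore]; `s = (m+1)·p`, `L̂ = Lhat s`, `D̂ = Dhat 4 s`, `N̂ = Nhat r (m+1) p`, `Ĉ = N̂(N̂ᵀL̂L̂N̂)⁻¹N̂ᵀ`).
* §1 `trace_compress`, **`hessT_compress`**: `hessT X (NᵀYₛN) (NᵀYₜN) (NᵀYₛₜN) = hessT (N·X·Nᵀ) Yₛ Yₜ Yₛₜ` (any `X`, any `N`).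
* §2 `submatrix_mul_submatrix_equiv`; **`Tjet_mul_basis`**: `((NᵀM).submatrix id e₁)·(D̂ₛ·N) = Nᵀ(M·D̂)N`; `Mjet₀_mul_Dhat : M̂₀·D̂ = L̂·L̂`.
* §3 **`hessT_ghostTerm_Nhat`** — the displayed evaluation of TB5-1's Φ-term at the TB4-W jets.
* §4 **`hessT_transfer_road_ghost`** — TB5-1 with §3 substituted: `hessT (M_T⁻¹|_{ν⊕μ}; kkt K• Q•) + (2·hessT (Ĉ; M̂•D̂) − hessT (Ĉ; (L̂²)•))
  = hessT (blocksHat p (sortK (m+1) (NlegRoad m a)); kkt (K• + B•) Q•)`, `B• = gram• (Tjet₀, Tjet₁ b, Tjet₁ b′, Tjet₁₁ b b′; Ajet₀, Ajet₁ b, Ajet₁ b′, Ajet₁₁ b b′)`.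
Unit `b2b-balaban-beta-d1-p2` (road owner, gen 7).
-/

noncomputable section

namespace Summit.QuantumFields.BalabanUV.Beta.D1BFx.KGhostTerm

open Matrix
open scoped BigOperators
open Literature.MathematicalPhysics.QuantumFieldTheory.Balaban1983to89
open Literature.MathematicalPhysics.QuantumFieldTheory.Balaban1983to89.Beta
open Literature.MathematicalPhysics.QuantumFieldTheory.Balaban1983to89.Beta.Composition (kkt)
open AffineAveraging (box toSite)
open Summit.QuantumFields.BalabanUV.Beta.TameKernelCalculus (Spr)
open Summit.QuantumFields.BalabanUV.Beta.D1BFx.SortedKernels (blocksHat)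
open Summit.QuantumFields.BalabanUV.Beta.D1BFx.SortedPack (sortK)
open Summit.QuantumFields.BalabanUV.Beta.D1BFx.SortedEmbedding (e₁)
open Summit.QuantumFields.BalabanUV.Beta.D1BFx.TorusCombKKT (I J CombRows tauT Khat Qhat)
open Summit.QuantumFields.BalabanUV.Beta.D1BFx.TorusGaugeBasis (What0)
open Summit.QuantumFields.BalabanUV.Beta.D1BFx.PeriodisedProjector (Lhat Shat)
open Summit.QuantumFields.BalabanUV.Beta.D1BFx.TorusHodgeWeight (Dhat DhatS Dhat_transpose_mul_Dhat)
open Summit.QuantumFields.BalabanUV.Beta.D1BFx.TorusZerothJunction (det_coframe_mul_basis_road_ne_zero det_weightA_road_ne_zero)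
open Summit.QuantumFields.BalabanUV.Beta.D1BFx.MixedVarPackedHess (hessT)
open Summit.QuantumFields.BalabanUV.Beta.D1BFx.GramWeightJets (gram₀ gram₁)
open Summit.QuantumFields.BalabanUV.Beta.D1BFx.GramWeightJetsMixed (gramMix hessT_gram_split_jets)
open Summit.QuantumFields.BalabanUV.Beta.D1BFx.RWeightedLegPack (NlegRoad)
open Summit.QuantumFields.BalabanUV.Beta.D1BFx.TorusGaugeBasisMatrix (Nhat)
open Summit.QuantumFields.BalabanUV.Beta.D1BFx.TorusGaugeBasisKernel (Nhat_range Nhat_injective What0_eq_DhatS_mul_Nhat)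
open Summit.QuantumFields.BalabanUV.Beta.D1BFx.KTransferTorus (gram₁_zero_basis gramMix_zero_basis gram₀_eq hessT_transfer_road_Nhat)
open Summit.QuantumFields.BalabanUV.Beta.D1BFx.TorusCoframeJets (Djet Ljet Ljet₁₁ Mjet₀ Mjet₁ Mjet₁₁ Tjet₀ Tjet₁ Tjet₁₁ Gjet₀ Gjet₁ Gjet₁₁
  Ajet₀ Ajet₁ Ajet₁₁ Tjet₀_eq_coframe hessT_Ajet_road)

/-! ## §1 Compression to the site space: the comb index `ρ` is eliminated by trace cyclicity -/

section Compress

variable {σ ρ : Type*} [Fintype σ] [Fintype ρ]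

/-- [folklore] `tr (X·(NᵀYN)) = tr ((N·X·Nᵀ)·Y)`. -/
theorem trace_compress (N : Matrix σ ρ ℝ) (X : Matrix ρ ρ ℝ) (Y : Matrix σ σ ℝ) :
    (X * (Nᵀ * Y * N)).trace = (N * X * Nᵀ * Y).trace := by
  rw [show X * (Nᵀ * Y * N) = (X * Nᵀ * Y) * N by simp only [Matrix.mul_assoc], Matrix.trace_mul_comm]
  simp only [Matrix.mul_assoc]

/-- [folklore] `tr (X·(NᵀYN)·(X·(NᵀY′N))) = tr ((NXNᵀ)·Y·((NXNᵀ)·Y′))`. -/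
theorem trace_compress₂ (N : Matrix σ ρ ℝ) (X : Matrix ρ ρ ℝ) (Y Y' : Matrix σ σ ℝ) :
    (X * (Nᵀ * Y * N) * (X * (Nᵀ * Y' * N))).trace = (N * X * Nᵀ * Y * (N * X * Nᵀ * Y')).trace := by
  rw [show X * (Nᵀ * Y * N) * (X * (Nᵀ * Y' * N)) = (X * Nᵀ * Y * (N * X * Nᵀ) * Y') * N by simp only [Matrix.mul_assoc],
    Matrix.trace_mul_comm]
  simp only [Matrix.mul_assoc]

/-- [folklore] **COMPRESSION TO THE SITE SPACE**: for ANY `X : ρ×ρ`, `N : σ×ρ` and site words `Yₛ Yₜ Yₛₜ`,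
`hessT X (NᵀYₛN) (NᵀYₜN) (NᵀYₛₜN) = hessT (N·X·Nᵀ) Yₛ Yₜ Yₛₜ` — the `ρ`-indexed one-loop functional of compressed jets IS the `σ`-indexed one-loop
functional with the compressed leg `N·X·Nᵀ`. -/
theorem hessT_compress (N : Matrix σ ρ ℝ) (X : Matrix ρ ρ ℝ) (Yₛ Yₜ Yₛₜ : Matrix σ σ ℝ) :
    hessT X (Nᵀ * Yₛ * N) (Nᵀ * Yₜ * N) (Nᵀ * Yₛₜ * N) = hessT (N * X * Nᵀ) Yₛ Yₜ Yₛₜ := by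
  unfold hessT
  rw [trace_compress, trace_compress₂]

end Compress

/-! ## §2 Re-indexing over the `Equiv` `e₁`: the co-frame jets act on the basis through `M̂•·D̂` -/

section Reindex

/-- [folklore] `(A.submatrix id e)·(B.submatrix e id) = A·B` for an `Equiv` `e` (re-indexing the summation variable). -/
theorem submatrix_mul_submatrix_equiv {α β γ δ : Type*} [Fintype β] [Fintype δ] (A : Matrix α β ℝ) (B : Matrix β γ ℝ) (e : δ ≃ β) :
    A.submatrix id e * B.submatrix e id = A * B := by
  ext i j
  simp only [Matrix.mul_apply, Matrix.submatrix_apply, id]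
  exact e.sum_comp (fun b => A i b * B b j)

variable (m : ℕ) (p : ℕ) [NeZero p] {ρ : Type*}

/-- [folklore] **THE CO-FRAME JETS ACT ON A BASIS THROUGH `M̂•·D̂`**: `((NᵀM).submatrix id e₁)·(D̂ₛ·N′) = Nᵀ·(M·D̂)·N′` on the road (`D̂ₛ = D̂.submatrix e₁ id`). -/
theorem Tjet_mul_basis (N : Matrix (Site 4 ((m + 1) * p)) ρ ℝ) (M : Matrix (Site 4 ((m + 1) * p)) (Site 4 ((m + 1) * p) × Fin 4) ℝ)
    {ρ' : Type*} (N' : Matrix (Site 4 ((m + 1) * p)) ρ' ℝ) :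
    (Nᵀ * M).submatrix id (e₁ (m + 1) p) * (DhatS m p * N') = Nᵀ * (M * Dhat 4 ((m + 1) * p)) * N' := by
  rw [DhatS, ← Matrix.mul_assoc, submatrix_mul_submatrix_equiv]
  simp only [Matrix.mul_assoc]

/-- [folklore] `M̂₀·D̂ = L̂·L̂` (`M̂₀ = L̂D̂ᵀ`, `D̂ᵀD̂ = L̂`, `TorusHodgeWeight.Dhat_transpose_mul_Dhat`). -/
theorem Mjet₀_mul_Dhat (s : ℕ) [NeZero s] : Mjet₀ s * Dhat 4 s = Lhat s * Lhat s := by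
  rw [Mjet₀, Matrix.mul_assoc, Dhat_transpose_mul_Dhat]

end Reindex

/-! ## §3 The ghost term of TB5-1 at the TB4-W jets, comb-free -/

section Ghost

variable (m : ℕ) {a : ℝ} (p : ℕ) [NeZero p] {r : Fin 4 → ℕ}

/-- [folklore] **TB5-2c-A: THE GHOST TERM OF ROUTE T UNDER (R2), COMB-FREE.**  At `N := N̂`, `Ŵ₀ = D̂ₛN̂`, `T₀ = N̂ᵀL̂D̂ₛᵀ`, `A₀ = 2•(N̂ᵀL̂L̂N̂)⁻¹` and the
TB4-W jets `Tₛ = Tjet₁ b`, `Tₜ = Tjet₁ b′`, `Tₛₜ = Tjet₁₁ b b′`, `Aₛ = Ajet₁ b`, `Aₜ = Ajet₁ b′`, `Aₛₜ = Ajet₁₁ b b′`: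
`hessT ((Ŵ₀ᵀB₀Ŵ₀)⁻¹; Ŵ₀ᵀBₛŴ₀, Ŵ₀ᵀBₜŴ₀, Ŵ₀ᵀBₛₜŴ₀) = 2·hessT (Ĉ; M̂ₛD̂, M̂ₜD̂, M̂ₛₜD̂) − hessT (Ĉ; (L̂²)ₛ, (L̂²)ₜ, (L̂²)ₛₜ)`,
`Ĉ = N̂(N̂ᵀL̂L̂N̂)⁻¹N̂ᵀ`, `(L̂²)ₛ = ĴₛL̂ + L̂Ĵₛ` (`Ĵ = Ljet`), `(L̂²)ₛₜ = Ĵₛₜ L̂ + ĴₛĴₜ + ĴₜĴₛ + L̂Ĵₛₜ` (`0 < a`, `r ∈ box 4 (m+1)`). -/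
theorem hessT_ghostTerm_Nhat (ha : 0 < a) (hr : r ∈ box 4 (m + 1))
    (b b' : Site 4 ((m + 1) * p) × Fin 4) :
    hessT ((What0 r (m + 1) p)ᵀ
            * (((Nhat r (m + 1) p)ᵀ * Lhat ((m + 1) * p) * (DhatS m p)ᵀ)ᵀ
                * ((2 : ℝ) • ((Nhat r (m + 1) p)ᵀ * Lhat ((m + 1) * p) * Lhat ((m + 1) * p) * Nhat r (m + 1) p)⁻¹)
                * ((Nhat r (m + 1) p)ᵀ * Lhat ((m + 1) * p) * (DhatS m p)ᵀ))
            * What0 r (m + 1) p)⁻¹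
          ((What0 r (m + 1) p)ᵀ
            * gram₁ ((Nhat r (m + 1) p)ᵀ * Lhat ((m + 1) * p) * (DhatS m p)ᵀ)
                (Tjet₁ ((m + 1) * p) b (Nhat r (m + 1) p) (e₁ (m + 1) p))
                ((2 : ℝ) • ((Nhat r (m + 1) p)ᵀ * Lhat ((m + 1) * p) * Lhat ((m + 1) * p) * Nhat r (m + 1) p)⁻¹)
                (Ajet₁ ((m + 1) * p) b (Nhat r (m + 1) p))
            * What0 r (m + 1) p)
          ((What0 r (m + 1) p)ᵀ
            * gram₁ ((Nhat r (m + 1) p)ᵀ * Lhat ((m + 1) * p) * (DhatS m p)ᵀ)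
                (Tjet₁ ((m + 1) * p) b' (Nhat r (m + 1) p) (e₁ (m + 1) p))
                ((2 : ℝ) • ((Nhat r (m + 1) p)ᵀ * Lhat ((m + 1) * p) * Lhat ((m + 1) * p) * Nhat r (m + 1) p)⁻¹)
                (Ajet₁ ((m + 1) * p) b' (Nhat r (m + 1) p))
            * What0 r (m + 1) p)
          ((What0 r (m + 1) p)ᵀ
            * gramMix ((Nhat r (m + 1) p)ᵀ * Lhat ((m + 1) * p) * (DhatS m p)ᵀ)
                (Tjet₁ ((m + 1) * p) b (Nhat r (m + 1) p) (e₁ (m + 1) p))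
                (Tjet₁ ((m + 1) * p) b' (Nhat r (m + 1) p) (e₁ (m + 1) p))
                (Tjet₁₁ ((m + 1) * p) b b' (Nhat r (m + 1) p) (e₁ (m + 1) p))
                ((2 : ℝ) • ((Nhat r (m + 1) p)ᵀ * Lhat ((m + 1) * p) * Lhat ((m + 1) * p) * Nhat r (m + 1) p)⁻¹)
                (Ajet₁ ((m + 1) * p) b (Nhat r (m + 1) p)) (Ajet₁ ((m + 1) * p) b' (Nhat r (m + 1) p))
                (Ajet₁₁ ((m + 1) * p) b b' (Nhat r (m + 1) p))
            * What0 r (m + 1) p)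
      = 2 * hessT (Nhat r (m + 1) p * ((Nhat r (m + 1) p)ᵀ * Lhat ((m + 1) * p) * Lhat ((m + 1) * p) * Nhat r (m + 1) p)⁻¹
              * (Nhat r (m + 1) p)ᵀ)
            (Mjet₁ ((m + 1) * p) b * Dhat 4 ((m + 1) * p)) (Mjet₁ ((m + 1) * p) b' * Dhat 4 ((m + 1) * p))
            (Mjet₁₁ ((m + 1) * p) b b' * Dhat 4 ((m + 1) * p))
        - hessT (Nhat r (m + 1) p * ((Nhat r (m + 1) p)ᵀ * Lhat ((m + 1) * p) * Lhat ((m + 1) * p) * Nhat r (m + 1) p)⁻¹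
              * (Nhat r (m + 1) p)ᵀ)
            (Ljet ((m + 1) * p) b * Lhat ((m + 1) * p) + Lhat ((m + 1) * p) * Ljet ((m + 1) * p) b)
            (Ljet ((m + 1) * p) b' * Lhat ((m + 1) * p) + Lhat ((m + 1) * p) * Ljet ((m + 1) * p) b')
            (Ljet₁₁ ((m + 1) * p) b b' * Lhat ((m + 1) * p) + Ljet ((m + 1) * p) b * Ljet ((m + 1) * p) b'
              + Ljet ((m + 1) * p) b' * Ljet ((m + 1) * p) b + Lhat ((m + 1) * p) * Ljet₁₁ ((m + 1) * p) b b') := by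
  -- abbreviations (no `set` on terms occurring in binder types)
  set N := Nhat r (m + 1) p with hNdef
  set L := Lhat ((m + 1) * p) with hL
  set W₀ := What0 r (m + 1) p with hW₀
  set T₀ : Matrix (CombRows (toSite r) (m + 1) p) (I 3 (m + 1) p) ℝ := Nᵀ * L * (DhatS m p)ᵀ with hT₀
  set G₀ : Matrix (CombRows (toSite r) (m + 1) p) (CombRows (toSite r) (m + 1) p) ℝ := Nᵀ * L * L * N with hG₀
  set A₀ : Matrix (CombRows (toSite r) (m + 1) p) (CombRows (toSite r) (m + 1) p) ℝ := (2 : ℝ) • G₀⁻¹ with hA₀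
  -- the basis facts of `N̂` («K-TB3b-N») and the two determinant letters
  have hN := Nhat_range r m p hr
  have hNinj := Nhat_injective r (m + 1) p hr
  have hW : W₀ = DhatS m p * N := What0_eq_DhatS_mul_Nhat r m p hr
  have hT : (T₀ * W₀).det ≠ 0 := by
    rw [hW]; exact det_coframe_mul_basis_road_ne_zero m p ha hN hNinj
  have hA : A₀.det ≠ 0 := det_weightA_road_ne_zero m p ha hN hNinj
  -- `hessT_gram_split_jets` with all `W`-jets (and the unused pure second jets) zero
  have h := hessT_gram_split_jets T₀ (Tjet₁ ((m + 1) * p) b N (e₁ (m + 1) p)) (Tjet₁ ((m + 1) * p) b' N (e₁ (m + 1) p)) 0 0 (Tjet₁₁ ((m + 1) * p) b b' N (e₁ (m + 1) p))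
    A₀ (Ajet₁ ((m + 1) * p) b N) (Ajet₁ ((m + 1) * p) b' N) 0 0 (Ajet₁₁ ((m + 1) * p) b b' N) W₀ 0 0 0 0 0 hT hA
  rw [gram₁_zero_basis, gram₁_zero_basis, gramMix_zero_basis, gram₀_eq, gram₀_eq] at h
  simp only [Matrix.mul_zero, add_zero] at h
  rw [h]
  -- the `A`-term is minus the bi-Laplacian Gram term (`TorusCoframeJets.hessT_Ajet_road`), `A₀ = Ajet₀ s N` by `rfl`
  have hAt : hessT A₀⁻¹ (Ajet₁ ((m + 1) * p) b N) (Ajet₁ ((m + 1) * p) b' N) (Ajet₁₁ ((m + 1) * p) b b' N)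
      = -hessT (Gjet₀ ((m + 1) * p) N)⁻¹ (Gjet₁ ((m + 1) * p) b N) (Gjet₁ ((m + 1) * p) b' N) (Gjet₁₁ ((m + 1) * p) b b' N) := hessT_Ajet_road m p ha hN hNinj b b'
  rw [hAt]
  -- the `X`-words: `T•·Ŵ₀ = N̂ᵀ(M̂•D̂)N̂`, `T₀Ŵ₀ = N̂ᵀL̂L̂N̂`
  have hX₀ : T₀ * W₀ = Nᵀ * (L * L) * N := by
    rw [hT₀, ← Tjet₀_eq_coframe m p N, hW, Tjet₀, Tjet_mul_basis, Mjet₀_mul_Dhat]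
  have hXs : Tjet₁ ((m + 1) * p) b N (e₁ (m + 1) p) * W₀ = Nᵀ * (Mjet₁ ((m + 1) * p) b * Dhat 4 ((m + 1) * p)) * N := by rw [hW, Tjet₁, Tjet_mul_basis]
  have hXt : Tjet₁ ((m + 1) * p) b' N (e₁ (m + 1) p) * W₀ = Nᵀ * (Mjet₁ ((m + 1) * p) b' * Dhat 4 ((m + 1) * p)) * N := by rw [hW, Tjet₁, Tjet_mul_basis]
  have hXst : Tjet₁₁ ((m + 1) * p) b b' N (e₁ (m + 1) p) * W₀ = Nᵀ * (Mjet₁₁ ((m + 1) * p) b b' * Dhat 4 ((m + 1) * p)) * N := by rw [hW, Tjet₁₁, Tjet_mul_basis]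
  rw [hX₀, hXs, hXt, hXst, hessT_compress]
  -- the `G`-words
  have hG₀' : Gjet₀ ((m + 1) * p) N = Nᵀ * (L * L) * N := by rw [Gjet₀, hL]; simp only [Matrix.mul_assoc]
  rw [hG₀', Gjet₁, Gjet₁, Gjet₁₁, hessT_compress]
  have hG₀'' : Nᵀ * (L * L) * N = G₀ := by rw [hG₀]; simp only [Matrix.mul_assoc]
  rw [hG₀'']
  ring

end Ghost

/-! ## §4 TB5-1 with the comb-free ghost term -/

section Transfer

variable (m : ℕ) {a : ℝ} (p : ℕ) [NeZero p] {r : Fin 4 → ℕ}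

/-- [folklore] **THE PER-TORUS IDENTITY OF ROUTE T UNDER (R2), EVERY FUNCTIONAL «ONE LEG × LOCAL JETS»**: TB5-1 `hessT_transfer_road_Nhat` at the TB4-W
weight jets, with its ghost term rewritten by `hessT_ghostTerm_Nhat`:
`hessT (M_T⁻¹|_{ν⊕μ}; kkt Kₛ Qₛ, kkt Kₜ Qₜ, kkt Kₛₜ Qₛₜ) + (2·hessT (Ĉ; M̂ₛD̂, M̂ₜD̂, M̂ₛₜD̂) − hessT (Ĉ; (L̂²)ₛ, (L̂²)ₜ, (L̂²)ₛₜ))`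
`= hessT (blocksHat p (sortK (m+1) (NlegRoad m a)); kkt (Kₛ + Bₛ) Qₛ, kkt (Kₜ + Bₜ) Qₜ, kkt (Kₛₜ + Bₛₜ) Qₛₜ)`,
`Bₛ = gram₁ T̂₀ (Tjet₁ b) Â₀ (Ajet₁ b)`, `Bₜ = gram₁ T̂₀ (Tjet₁ b′) Â₀ (Ajet₁ b′)`, `Bₛₜ = gramMix T̂₀ (Tjet₁ b) (Tjet₁ b′) (Tjet₁₁ b b′) Â₀ (Ajet₁ b) (Ajet₁ b′) (Ajet₁₁ b b′)`
(`T̂₀ = Tjet₀ N̂ e₁`, `Â₀ = Ajet₀ N̂`).  Displayed: the table jets + kinematic Ward letters, `Spr (Ga (m+1) a)`. -/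
theorem hessT_transfer_road_ghost (ha : 0 < a) (hGa : Spr (GluonLeg.Ga (m + 1) a)) (hr : r ∈ box 4 (m + 1))
    (b b' : Site 4 ((m + 1) * p) × Fin 4)
    (Kₛ Kₜ Kₛₜ : Matrix (I 3 (m + 1) p) (I 3 (m + 1) p) ℝ) (Qₛ Qₜ Qₛₜ : Matrix (J 3 p) (I 3 (m + 1) p) ℝ)
    (kₛ : Kₛ * What0 r (m + 1) p = 0) (kₛt : Kₛᵀ * What0 r (m + 1) p = 0)
    (kₜ : Kₜ * What0 r (m + 1) p = 0) (kₜt : Kₜᵀ * What0 r (m + 1) p = 0)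
    (kₛₜ : Kₛₜ * What0 r (m + 1) p = 0) (kₛₜt : Kₛₜᵀ * What0 r (m + 1) p = 0)
    (qₛ : Qₛ * What0 r (m + 1) p = 0) (qₜ : Qₜ * What0 r (m + 1) p = 0) (qₛₜ : Qₛₜ * What0 r (m + 1) p = 0) :
    hessT ((kkt (Khat (d := 3) (m + 1) p) (Matrix.fromRows (Qhat (d := 3) (m + 1) p) (tauT (toSite r) (m + 1) p)))⁻¹.submatrix
          (Sum.map id Sum.inl) (Sum.map id Sum.inl)) (kkt Kₛ Qₛ) (kkt Kₜ Qₜ) (kkt Kₛₜ Qₛₜ)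
      + (2 * hessT (Nhat r (m + 1) p * ((Nhat r (m + 1) p)ᵀ * Lhat ((m + 1) * p) * Lhat ((m + 1) * p) * Nhat r (m + 1) p)⁻¹
              * (Nhat r (m + 1) p)ᵀ)
            (Mjet₁ ((m + 1) * p) b * Dhat 4 ((m + 1) * p)) (Mjet₁ ((m + 1) * p) b' * Dhat 4 ((m + 1) * p))
            (Mjet₁₁ ((m + 1) * p) b b' * Dhat 4 ((m + 1) * p))
        - hessT (Nhat r (m + 1) p * ((Nhat r (m + 1) p)ᵀ * Lhat ((m + 1) * p) * Lhat ((m + 1) * p) * Nhat r (m + 1) p)⁻¹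
              * (Nhat r (m + 1) p)ᵀ)
            (Ljet ((m + 1) * p) b * Lhat ((m + 1) * p) + Lhat ((m + 1) * p) * Ljet ((m + 1) * p) b)
            (Ljet ((m + 1) * p) b' * Lhat ((m + 1) * p) + Lhat ((m + 1) * p) * Ljet ((m + 1) * p) b')
            (Ljet₁₁ ((m + 1) * p) b b' * Lhat ((m + 1) * p) + Ljet ((m + 1) * p) b * Ljet ((m + 1) * p) b'
              + Ljet ((m + 1) * p) b' * Ljet ((m + 1) * p) b + Lhat ((m + 1) * p) * Ljet₁₁ ((m + 1) * p) b b'))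
    = hessT (blocksHat p (sortK (m + 1) (NlegRoad m a)))
        (kkt (Kₛ + gram₁ (Tjet₀ ((m + 1) * p) (Nhat r (m + 1) p) (e₁ (m + 1) p)) (Tjet₁ ((m + 1) * p) b (Nhat r (m + 1) p) (e₁ (m + 1) p))
          (Ajet₀ ((m + 1) * p) (Nhat r (m + 1) p)) (Ajet₁ ((m + 1) * p) b (Nhat r (m + 1) p))) Qₛ)
        (kkt (Kₜ + gram₁ (Tjet₀ ((m + 1) * p) (Nhat r (m + 1) p) (e₁ (m + 1) p)) (Tjet₁ ((m + 1) * p) b' (Nhat r (m + 1) p) (e₁ (m + 1) p))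
          (Ajet₀ ((m + 1) * p) (Nhat r (m + 1) p)) (Ajet₁ ((m + 1) * p) b' (Nhat r (m + 1) p))) Qₜ)
        (kkt (Kₛₜ + gramMix (Tjet₀ ((m + 1) * p) (Nhat r (m + 1) p) (e₁ (m + 1) p))
          (Tjet₁ ((m + 1) * p) b (Nhat r (m + 1) p) (e₁ (m + 1) p)) (Tjet₁ ((m + 1) * p) b' (Nhat r (m + 1) p) (e₁ (m + 1) p))
          (Tjet₁₁ ((m + 1) * p) b b' (Nhat r (m + 1) p) (e₁ (m + 1) p))
          (Ajet₀ ((m + 1) * p) (Nhat r (m + 1) p)) (Ajet₁ ((m + 1) * p) b (Nhat r (m + 1) p)) (Ajet₁ ((m + 1) * p) b' (Nhat r (m + 1) p))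
          (Ajet₁₁ ((m + 1) * p) b b' (Nhat r (m + 1) p))) Qₛₜ) := by
  have h := hessT_transfer_road_Nhat m p ha hGa hr Kₛ Kₜ Kₛₜ Qₛ Qₜ Qₛₜ
    (Tjet₁ ((m + 1) * p) b (Nhat r (m + 1) p) (e₁ (m + 1) p)) (Tjet₁ ((m + 1) * p) b' (Nhat r (m + 1) p) (e₁ (m + 1) p))
    (Tjet₁₁ ((m + 1) * p) b b' (Nhat r (m + 1) p) (e₁ (m + 1) p))
    (Ajet₁ ((m + 1) * p) b (Nhat r (m + 1) p)) (Ajet₁ ((m + 1) * p) b' (Nhat r (m + 1) p)) (Ajet₁₁ ((m + 1) * p) b b' (Nhat r (m + 1) p))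
    kₛ kₛt kₜ kₜt kₛₜ kₛₜt qₛ qₜ qₛₜ
  rw [hessT_ghostTerm_Nhat m p ha hr b b'] at h
  rw [Tjet₀_eq_coframe, Ajet₀]
  exact h

end Transfer

end Summit.QuantumFields.BalabanUV.Beta.D1BFx.KGhostTerm

end
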